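import Summits.QuantumFields.YangMills.Theorems.BalabanLadderROTWardShapeDeriv
import HarnessLib

/-!
# Crux `ROT` (stmt-QuantumFields-20042), infinitesimal Ward route (lane B) — IX: the HYPERCUBIC-invariant profile and generic germ-class test functions

Helper file (`--supports stmt-QuantumFields-20042`, lane `ym-rot-20042-p2`).  Second-generation shape witness answering the natural
objection to `…WardShape.lean` («the real torus moments are hypercubic-symmetric»):

* §1 the profile `h_c(z) = η(‖z‖²) Σ_μ (z^μ)⁴` — smooth, compactly supported (`= 0` for `‖z‖ ≥ 2`), `|h_c| ≤ 4`, invariant under every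
  permutation and sign change of the coordinates (`hcFun_hypercubic`), with angular derivative
  `∂_θ h_c = q`, `q(z) = η(‖z‖²)·4 z⁰z¹((z¹)² − (z⁰)²)` (`angDeriv_hcFun`) — non-zero arbitrarily close to the origin;
* §2 generic germ-class test functions `T_{φ,s}(w) = φ(w₀−w₁) χ_s(w₀−w₁) ψ(w₁)` for an arbitrary smooth one-slot profile `φ`
  (`TestS`, Mathlib `HasCompactSupport.toSchwartzMap`): support in the annulus `s²/2 ≤ ‖w₀−w₁‖² ≤ 3s²/2` and in the ball of radius
  `4`, membership `T_{φ,s} ∈ KingClass 2 r₀` for `2s < r₀`.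

Pure Mathlib calculus; no statement about Yang–Mills.  No fact, no sorry.
-/

set_option autoImplicit false

noncomputable section

open scoped SchwartzMap BigOperators RealInnerProductSpace ContDiff
open MeasureTheory Filter Topology Metric
open Literature.MathematicalPhysics.QuantumFieldTheory Literature.MathematicalPhysics.QuantumLattice
open Literature.MathematicalPhysics.AQFT
open Literature.Probability.LatticeModels (box Site mem_box)
open Summit.QuantumFields.YangMills.Cruxes.OSLegsFromFemtoAndGap.DlrCollarTransfer (MomentBounds)
open Summit.QuantumFields.YangMills.Cruxes.OSLegsAtWeakCouplingC.Sketch (Separated SmallDiam)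
open Summit.QuantumFields.YangMills.Cruxes.OSLegsAtWeakCouplingC.Y2Bridge (LatticeRotWard)
open Summit.QuantumFields.YangMills.Cruxes.OSLegsAtWeakCouplingC.Y2Bridge.King (KingClass)
open Summit.QuantumFields.YangMills.Theorems.OSLegsFromFemtoAndGap (torusMoment mul_norm_le_norm_smul_siteToE
  norm_smul_siteToE_sub_le abs_coord_le_norm_siteToE siteToE_sub)
open Summit.QuantumFields.YangMills.Theorems.NPointIsotropy.Negative (E4)

namespace Summit.QuantumFields.YangMills.Theorems.ROT.Ward

/-! ## §1 The hypercubic-invariant profile `h_c(z) = η(‖z‖²) Σ_μ (z^μ)⁴` and its angular derivative -/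

section Cubic

/-- The hypercubic-invariant profile `h_c(z) = η(‖z‖²) Σ_μ (z^μ)⁴` (invariant under permutations and sign changes of the coordinates,
NOT rotation invariant). -/
def hcFun (z : E4) : ℝ := eta (‖z‖ ^ 2) * ∑ μ : Fin 4, (z μ) ^ 4

/-- Its angular derivative, explicitly: `∂_θ h_c(z) = η(‖z‖²) · 4 z⁰ z¹ ((z¹)² − (z⁰)²)`. -/
def qFun (z : E4) : ℝ := eta (‖z‖ ^ 2) * (4 * z 0 * z 1 * ((z 1) ^ 2 - (z 0) ^ 2))

/-- **Hypercubic invariance of `h_c`**: for every permutation `σ` of the axes and signs `ε_μ ∈ {±1}`,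
`h_c(ε_μ z_{σ μ}) = h_c(z)`. -/
theorem hcFun_hypercubic (σ : Equiv.Perm (Fin 4)) (ε : Fin 4 → ℝ) (hε : ∀ μ, ε μ = 1 ∨ ε μ = -1) (z : E4) :
    hcFun (WithLp.toLp 2 fun μ => ε μ * z (σ μ)) = hcFun z := by
  have hε2 : ∀ μ, ε μ ^ 2 = 1 := fun μ => by rcases hε μ with h | h <;> simp [h]
  have hε4 : ∀ μ, ε μ ^ 4 = 1 := fun μ => by rw [show (4 : ℕ) = 2 * 2 from rfl, pow_mul, hε2, one_pow]
  have hnorm : ‖(WithLp.toLp 2 fun μ => ε μ * z (σ μ) : E4)‖ ^ 2 = ‖z‖ ^ 2 := by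
    rw [EuclideanSpace.norm_sq_eq, EuclideanSpace.norm_sq_eq]
    simp only [Real.norm_eq_abs, sq_abs, mul_pow, hε2, one_mul]
    exact Equiv.sum_comp σ (fun μ => (z μ) ^ 2)
  unfold hcFun
  rw [hnorm]
  congr 1
  simp only [mul_pow, hε4, one_mul]
  exact Equiv.sum_comp σ (fun μ => (z μ) ^ 4)

/-- `h_c` is NOT rotation invariant in the `(x₀,x₁)`-plane: its angular derivative is `qFun`, which does not vanish identically
(`qFun_ne_zero_at`). First the derivative of a fourth power of a coordinate along the generator. -/
theorem angDeriv_coord_pow_four (μ : Fin 4) (z : E4) : angDeriv (fun z : E4 => (z μ) ^ 4) z = 4 * (z μ) ^ 3 * rotVec z μ := by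
  unfold angDeriv
  have h : HasFDerivAt (fun z : E4 => (z μ) ^ 4) ((4 * (z μ) ^ 3) • (EuclideanSpace.proj μ : E4 →L[ℝ] ℝ)) z := by
    have h1 : HasFDerivAt (fun z : E4 => z μ) (EuclideanSpace.proj μ : E4 →L[ℝ] ℝ) z :=
      (EuclideanSpace.proj (μ : Fin 4) : E4 →L[ℝ] ℝ).hasFDerivAt
    simpa using h1.pow 4
  rw [h.fderiv]
  simp [smul_eq_mul]

/-- Coordinate `1` of the generator. -/
theorem rotVec_apply_one (z : E4) : rotVec z 1 = z 0 := by
  simp [rotVec]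

/-- Coordinate `2` of the generator vanishes. -/
theorem rotVec_apply_two (z : E4) : rotVec z 2 = 0 := by
  simp [rotVec]

/-- Coordinate `3` of the generator vanishes. -/
theorem rotVec_apply_three (z : E4) : rotVec z 3 = 0 := by
  simp [rotVec]

/-- `∂_θ h_c = q`. -/
theorem angDeriv_hcFun (z : E4) : angDeriv hcFun z = qFun z := by
  have h1 : DifferentiableAt ℝ (fun z : E4 => eta (‖z‖ ^ 2)) z :=
    ((contDiff_bump_norm_sq eta).differentiable (by simp)).differentiableAt
  have hpow : ∀ μ : Fin 4, DifferentiableAt ℝ (fun z : E4 => (z μ) ^ 4) z := fun μ =>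
    (((contDiff_coord μ).pow 4).differentiable (by simp)).differentiableAt
  have h2 : DifferentiableAt ℝ (fun z : E4 => ∑ μ : Fin 4, (z μ) ^ 4) z := by
    have : (fun z : E4 => ∑ μ : Fin 4, (z μ) ^ 4) = ∑ μ : Fin 4, fun z : E4 => (z μ) ^ 4 := by
      funext z; simp [Finset.sum_apply]
    rw [this]
    exact DifferentiableAt.sum fun μ _ => hpow μ
  have hsum : angDeriv (fun z : E4 => ∑ μ : Fin 4, (z μ) ^ 4) z = ∑ μ : Fin 4, 4 * (z μ) ^ 3 * rotVec z μ := by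
    unfold angDeriv
    have : (fun z : E4 => ∑ μ : Fin 4, (z μ) ^ 4) = ∑ μ : Fin 4, fun z : E4 => (z μ) ^ 4 := by
      funext z; simp [Finset.sum_apply]
    rw [this, fderiv_sum fun μ _ => hpow μ]
    simp only [FunLike.coe_sum, Finset.sum_apply]
    refine Finset.sum_congr rfl fun μ _ => ?_
    exact angDeriv_coord_pow_four μ z
  unfold hcFun qFun
  rw [angDeriv_mul _ _ z h1 h2, angDeriv_radial eta ((eta.contDiff (n := ⊤)).differentiable (by simp)) z, hsum]
  simp only [Fin.sum_univ_four, rotVec_apply_zero, rotVec_apply_one, rotVec_apply_two, rotVec_apply_three]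
  ring

/-- `q` is continuous. -/
theorem continuous_qFun : Continuous qFun := by
  unfold qFun
  have h0 := (contDiff_coord 0).continuous
  have h1 := (contDiff_coord 1).continuous
  exact (contDiff_bump_norm_sq eta).continuous.mul
    (((continuous_const.mul h0).mul h1).mul ((h1.pow 2).sub (h0.pow 2)))

/-- `q` is smooth. -/
theorem contDiff_qFun : ContDiff ℝ ∞ qFun := by
  unfold qFun
  exact (contDiff_bump_norm_sq eta).mul
    (((contDiff_const.mul (contDiff_coord 0)).mul (contDiff_coord 1)).mul (((contDiff_coord 1).pow 2).sub ((contDiff_coord 0).pow 2)))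

/-- `h_c` is smooth. -/
theorem contDiff_hcFun : ContDiff ℝ ∞ hcFun :=
  (contDiff_bump_norm_sq eta).mul (ContDiff.sum fun μ _ => (contDiff_coord μ).pow 4)

/-- `|h_c| ≤ 4` everywhere (on its support `‖z‖² < 2` one has `Σ z_μ⁴ ≤ (Σ z_μ²)² = ‖z‖⁴ < 4`). -/
theorem abs_hcFun_le (z : E4) : |hcFun z| ≤ 4 := by
  unfold hcFun
  have hsum0 : 0 ≤ ∑ μ : Fin 4, (z μ) ^ 4 := Finset.sum_nonneg fun μ _ => by positivity
  have hsq : ∑ μ : Fin 4, (z μ) ^ 4 ≤ (‖z‖ ^ 2) ^ 2 := by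
    rw [EuclideanSpace.norm_sq_eq]
    simp only [Real.norm_eq_abs, sq_abs, Fin.sum_univ_four]
    nlinarith [sq_nonneg (z 0), sq_nonneg (z 1), sq_nonneg (z 2), sq_nonneg (z 3)]
  by_cases hz : 2 ≤ ‖z‖ ^ 2
  · rw [ContDiffBump.zero_of_le_dist eta (by simpa [eta, Real.dist_eq] using hz)]
    simp
  · push Not at hz
    rw [abs_mul, abs_of_nonneg eta.nonneg, abs_of_nonneg hsum0]
    calc eta (‖z‖ ^ 2) * ∑ μ : Fin 4, (z μ) ^ 4 ≤ 1 * (‖z‖ ^ 2) ^ 2 :=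
          mul_le_mul eta.le_one hsq hsum0 zero_le_one
      _ ≤ 4 := by nlinarith [sq_nonneg ‖z‖]

/-- `h_c` vanishes for `‖z‖ ≥ 2`. -/
theorem hcFun_eq_zero_of_norm {z : E4} (hz : 2 ≤ ‖z‖) : hcFun z = 0 := by
  unfold hcFun
  rw [ContDiffBump.zero_of_le_dist eta (by simp [eta]; nlinarith)]
  simp

end Cubic

/-! ## §2 Generic germ-class test functions `φ(z) χ_s(z) ψ(w₁)` -/

section GenericTest

/-- The real two-slot test function `t_{φ,s}(w) = φ(w₀ − w₁) χ_s(w₀ − w₁) ψ(w₁)` for an arbitrary smooth one-slot profile `φ`. -/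
def testFun (φ : E4 → ℝ) (s : ℝ) (hs : 0 < s) (w : Fin 2 → E4) : ℝ := φ (w 0 - w 1) * chiFun s hs (w 0 - w 1) * psiFun (w 1)

/-- Where `t_{φ,s}` does not vanish. -/
theorem testFun_ne_zero {φ : E4 → ℝ} {s : ℝ} {hs : 0 < s} {w : Fin 2 → E4} (hw : testFun φ s hs w ≠ 0) :
    (s ^ 2 / 2 < ‖w 0 - w 1‖ ^ 2 ∧ ‖w 0 - w 1‖ ^ 2 < 3 * s ^ 2 / 2) ∧ ‖w 1‖ ^ 2 < 2 := by
  unfold testFun at hw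
  exact ⟨chiFun_ne_zero (right_ne_zero_of_mul (left_ne_zero_of_mul hw)), psiFun_ne_zero (right_ne_zero_of_mul hw)⟩

/-- For `s ≤ 1`, `t_{φ,s}` vanishes outside the ball of radius `4`. -/
theorem testFun_eq_zero_of_norm {φ : E4 → ℝ} {s : ℝ} {hs : 0 < s} (hs1 : s ≤ 1) {w : Fin 2 → E4} (hw : 4 < ‖w‖) :
    testFun φ s hs w = 0 := by
  by_contra hne
  obtain ⟨⟨-, h1⟩, h2⟩ := testFun_ne_zero hne
  have h3 : ‖w 0 - w 1‖ < 2 := by nlinarith [norm_nonneg (w 0 - w 1)]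
  have h4 : ‖w 1‖ < 2 := by nlinarith [norm_nonneg (w 1)]
  have h5 : ‖w 0‖ < 4 := by
    calc ‖w 0‖ = ‖(w 0 - w 1) + w 1‖ := by rw [sub_add_cancel]
      _ ≤ ‖w 0 - w 1‖ + ‖w 1‖ := norm_add_le _ _
      _ < 4 := by linarith
  have h6 : ‖w‖ ≤ 4 := by
    refine (pi_norm_le_iff_of_nonneg (by norm_num)).2 fun i => ?_
    fin_cases i
    · exact h5.le
    · exact (h4.trans (by norm_num)).le
  linarith

/-- Compact support of the complexified `t_{φ,s}` (`s ≤ 1`). -/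
theorem hasCompactSupport_testFun (φ : E4 → ℝ) {s : ℝ} (hs : 0 < s) (hs1 : s ≤ 1) :
    HasCompactSupport (fun w : Fin 2 → E4 => ((testFun φ s hs w : ℝ) : ℂ)) := by
  refine HasCompactSupport.intro (isCompact_closedBall (0 : Fin 2 → E4) 4) fun w hw => ?_
  rw [mem_closedBall, dist_zero_right, not_le] at hw
  rw [testFun_eq_zero_of_norm hs1 hw, Complex.ofReal_zero]

/-- Smoothness of `t_{φ,s}`. -/
theorem contDiff_testFun (φ : E4 → ℝ) (hφ : ContDiff ℝ ∞ φ) (s : ℝ) (hs : 0 < s) :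
    ContDiff ℝ ∞ (testFun φ s hs) := by
  have hP : ContDiff ℝ ∞ (fun w : Fin 2 → E4 => w 0 - w 1) := (contDiff_apply ℝ E4 (0 : Fin 2)).sub (contDiff_apply ℝ E4 1)
  have hQ : ContDiff ℝ ∞ (fun w : Fin 2 → E4 => w 1) := contDiff_apply ℝ E4 1
  unfold testFun
  exact ((hφ.comp hP).mul ((contDiff_bump_norm_sq (chiBump s hs)).comp hP)).mul (contDiff_psiFun.comp hQ)

/-- **The test function `T_{φ,s} ∈ 𝓢((ℝ⁴)², ℂ)`.** -/
def TestS (φ : E4 → ℝ) (hφ : ContDiff ℝ ∞ φ) (s : ℝ) (hs : 0 < s) (hs1 : s ≤ 1) : 𝓢((Fin 2 → E4), ℂ) :=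
  (hasCompactSupport_testFun φ hs hs1).toSchwartzMap (Complex.ofRealCLM.contDiff.comp (contDiff_testFun φ hφ s hs))

/-- Pointwise values of `T_{φ,s}`. -/
theorem TestS_apply (φ : E4 → ℝ) (hφ : ContDiff ℝ ∞ φ) (s : ℝ) (hs : 0 < s) (hs1 : s ≤ 1) (w : Fin 2 → E4) : TestS φ hφ s hs hs1 w = ((testFun φ s hs w : ℝ) : ℂ) := rfl

/-- The support of `T_{φ,s}` sits in the closed annulus `s²/2 ≤ ‖w₀ − w₁‖² ≤ 3s²/2`. -/
theorem tsupport_TestS_subset (φ : E4 → ℝ) (hφ : ContDiff ℝ ∞ φ) (s : ℝ) (hs : 0 < s) (hs1 : s ≤ 1) :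
    tsupport (TestS φ hφ s hs hs1 : (Fin 2 → E4) → ℂ) ⊆
      {w | s ^ 2 / 2 ≤ ‖w 0 - w 1‖ ^ 2 ∧ ‖w 0 - w 1‖ ^ 2 ≤ 3 * s ^ 2 / 2} := by
  have hcl : IsClosed {w : Fin 2 → E4 | s ^ 2 / 2 ≤ ‖w 0 - w 1‖ ^ 2 ∧ ‖w 0 - w 1‖ ^ 2 ≤ 3 * s ^ 2 / 2} := by
    have hc : Continuous fun w : Fin 2 → E4 => ‖w 0 - w 1‖ ^ 2 :=
      ((continuous_apply 0).sub (continuous_apply 1)).norm.pow 2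
    exact (isClosed_le continuous_const hc).inter (isClosed_le hc continuous_const)
  refine closure_minimal (fun w hw => ?_) hcl
  have hw' : testFun φ s hs w ≠ 0 := by
    intro h0; apply hw; show TestS φ hφ s hs hs1 w = 0; rw [TestS_apply, h0, Complex.ofReal_zero]
  obtain ⟨⟨h1, h2⟩, -⟩ := testFun_ne_zero hw'
  exact ⟨h1.le, h2.le⟩

/-- The support of `T_{φ,s}` sits in the ball of radius `4`. -/
theorem norm_le_of_mem_tsupport_TestS (φ : E4 → ℝ) (hφ : ContDiff ℝ ∞ φ) (s : ℝ) (hs : 0 < s) (hs1 : s ≤ 1)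
    {w : Fin 2 → E4}
    (hw : w ∈ tsupport (TestS φ hφ s hs hs1 : (Fin 2 → E4) → ℂ)) : ‖w‖ ≤ 4 := by
  have hsub : tsupport (TestS φ hφ s hs hs1 : (Fin 2 → E4) → ℂ) ⊆ closedBall 0 4 := by
    refine closure_minimal (fun w hw => ?_) isClosed_closedBall
    rw [mem_closedBall, dist_zero_right]
    by_contra h
    exact hw (by rw [TestS_apply, testFun_eq_zero_of_norm hs1 (not_le.1 h), Complex.ofReal_zero])
  have := hsub hw
  rwa [mem_closedBall, dist_zero_right] at this

/-- **`T_{φ,s} ∈ KingClass 2 r₀`** whenever `2s < r₀`. -/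
theorem TestS_mem_kingClass (φ : E4 → ℝ) (hφ : ContDiff ℝ ∞ φ) (s : ℝ) (hs : 0 < s) (hs1 : s ≤ 1) {r₀ : ℝ}
    (hr : 2 * s < r₀) : TestS φ hφ s hs hs1 ∈ KingClass 2 r₀ := by
  have hsupp := tsupport_TestS_subset φ hφ s hs hs1
  have hsep : tsupport (TestS φ hφ s hs hs1 : (Fin 2 → E4) → ℂ) ⊆ Separated 2 (s / 2) := by
    intro w hw i j hij
    obtain ⟨h1, -⟩ := hsupp hw
    have hz : s / 2 ≤ ‖w 0 - w 1‖ := by nlinarith [norm_nonneg (w 0 - w 1)]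
    fin_cases i <;> fin_cases j
    · exact absurd rfl hij
    · simpa [dist_eq_norm] using hz
    · simpa [dist_eq_norm, norm_sub_rev] using hz
    · exact absurd rfl hij
  refine ⟨?_, hasCompactSupport_testFun φ hs hs1, ⟨s / 2, by positivity, hsep⟩, ?_⟩
  · exact Summit.QuantumFields.YangMills.Cruxes.OSLegsAtWeakCouplingC.Sketch.GermWard.isOffDiagonal_of_tsupport_subset_separated
      (by positivity) hsep
  · intro w hw i j
    obtain ⟨-, h2⟩ := hsupp hw
    have hz : ‖w 0 - w 1‖ < 2 * s := by nlinarith [norm_nonneg (w 0 - w 1)]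
    have hr0 : 0 < r₀ := by linarith
    fin_cases i <;> fin_cases j
    · simpa using hr0
    · simp [dist_eq_norm]; linarith
    · simp [dist_eq_norm, norm_sub_rev]; linarith
    · simpa using hr0

end GenericTest

end Summit.QuantumFields.YangMills.Theorems.ROT.Ward

end
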